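import Literature.Analysis.FluidPDE.LocalEnergySolutionsOn
import Literature.Analysis.FluidPDE.LerayVelocityCubicDecay
import Literature.Analysis.FluidPDE.DistributionalToWeak
import HarnessLib

/-!
# Local integrability of `|v|³` and of the pressure for local Leray solutions on a slab

Analysis/FluidPDE theorem file (no new definitions) over the accepted slab classes
`IsLocalLeraySolutionOn T ν v₀ v π` (`LocalLeraySolutionsSlab.lean`: Kang–Miura–Tsai
Def. 3.2 on `(0, T)`, Lemarié-Rieusset 2016 Def. 14.1) and `IsLocalEnergySolutionOn`
(`LocalEnergySolutionsOn.lean`: Seregin 2014, Def. B.1).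

The sliced local energy inequality of the tree
(`IsSuitableWeakSolutionOn.ae_localEnergy_slice`, `SlicedLocalEnergy.lean`) and the
passage from the distributional equations to the weak form with datum
(`weakIdentity_datum_pressure_of_distributional`, `DistributionalToWeakPressure.lean`)
both ask for two integrability inputs which the definitions of the local Leray classes do
not list but imply:

* `|v|³ ∈ L¹_loc` on the open slab — for `v ∈ (L^∞_t L²_x)_uloc ∩ (L²_t H¹_x)_uloc` this is
  the standard interpolation "It is standard to see that `A` is finite by using properties
  2–5 and the Sobolev embedding" (Kang–Miura–Tsai 2021, after Lemma 3.3; Lemarié-Rieusset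
  2016, proof of Thm. 14.5, p. 511: the bound on `∫₀^{T₀}∫_{|x-y|<1} |u|³` by the `L^∞L²`
  and `L²Ḣ¹` quantities; Seregin 2014, (B.2.3): `γ(t) ≤ c (∫₀ᵗ α³)^{1/4} (β(t) + ∫₀ᵗ α)^{3/4}`),
  proved here on every box `(0, T) × B_ρ(y)` exactly as in the accepted
  `IsLocalLeraySolution.tendsto_lintegral_cube_cocompact` (`LerayVelocityCubicDecay.lean`:
  slice-wise Sobolev inequality on the ball with a centre-independent constant, Lebesgue
  interpolation `∫|f|³ ≤ (∫|f|²)^{3/4} (∫|f|⁶)^{1/4}`, Hölder in time);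
* `π ∈ L¹((0,T) × K)` for compact `K` — from the clause `π ∈ L^{3/2}((0,T) × K)` on the
  finite cylinder.

## Main results (all proved)

* `IsLocalLeraySolutionOn.lintegral_cube_box_le` / `…_lt_top` — for every centre `y` and
  radius `ρ`, `∫₀ᵀ∫_{B_ρ(y)} |v|³ ≤ K (∫₀ᵀ∫_{B_ρ(y)} |v|²)^{1/4} < ∞` with `K` independent
  of `y`;
* `IsLocalLeraySolutionOn.locallyIntegrableOn_cube` — `|v|³ ∈ L¹_loc` on the open slab
  `(0, T) × ℝ³` (the hypothesis `hu3` of `ae_localEnergy_slice`);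
* `IsLocalLeraySolutionOn.integrableOn_pressure` — `π ∈ L¹((0,T) × K)`, `K` compact;
* `IsLocalLeraySolutionOn.integrableOn_velocity` — `v, |v|² ∈ L¹((0,T) × K)`;
* the same four for `IsLocalEnergySolutionOn` (projection `isLocalLeraySolutionOn`).

The sibling `LocalLerayCubicIntegrability.lean` proves the corresponding statements for the
*global* class `IsLocalLeraySolution` (blocks `(0, b) × K` of `(0, ∞) × ℝ³`); the slab classes,
whose bounds are stated on `(0, T)` directly, are treated here.

## References

* K. Kang, H. Miura, T.-P. Tsai, IMRN 2021 = arXiv:1812.10509, §3, remark after Lemma 3.3.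
* G. Seregin, *Lecture notes on regularity theory for the Navier–Stokes equations* (2014),
  App. B, (B.2.3).
* P. G. Lemarié-Rieusset, *The Navier–Stokes problem in the 21st century* (2016), proof of
  Thm. 14.5, PDF p. 511.
* L. Caffarelli, R. Kohn, L. Nirenberg, CPAM 35 (1982), (2.8)–(2.10) (the interpolation).
-/

noncomputable section

open MeasureTheory TopologicalSpace Set Function Filter Metric
open _root_.Topology
open scoped ENNReal NNReal RealInnerProductSpace

namespace Literature.Analysis.FluidPDE

/-! ## An elementary inequality -/

/-- `a ≤ 1 + a^{3/2}` in `ℝ≥0∞` (split at `a ≤ 1`). [folklore] -/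
theorem ennreal_le_one_add_rpow_three_halves (a : ℝ≥0∞) : a ≤ 1 + a ^ (3 / 2 : ℝ) := by
  rcases le_or_gt a 1 with h | h
  · exact h.trans le_self_add
  · have h1 : a = a ^ (1 : ℝ) := (ENNReal.rpow_one a).symm
    have h2 : a ^ (1 : ℝ) ≤ a ^ (3 / 2 : ℝ) := ENNReal.rpow_le_rpow_of_exponent_le h.le (by norm_num)
    calc a = a ^ (1 : ℝ) := h1
      _ ≤ a ^ (3 / 2 : ℝ) := h2
      _ ≤ 1 + a ^ (3 / 2 : ℝ) := le_add_self

/-! ## The cubic functional on boxes -/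

namespace IsLocalLeraySolutionOn

variable {T ν : ℝ} {v₀ : EuclideanSpace ℝ (Fin 3) → EuclideanSpace ℝ (Fin 3)}
  {v : ℝ → EuclideanSpace ℝ (Fin 3) → EuclideanSpace ℝ (Fin 3)}
  {π : ℝ → EuclideanSpace ℝ (Fin 3) → ℝ}

/-- **The cubic functional of a local Leray solution on a slab is controlled by the local
energy** (Kang–Miura–Tsai 2021, remark after Lemma 3.3; Seregin 2014, (B.2.3);
Lemarié-Rieusset 2016, p. 511). For a local Leray solution `(v, π)` on `(0, T) × ℝ³` and
every radius `ρ` there is a finite constant `K` (built from the uniformly local energy and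
gradient bounds at radius `max ρ 1` and the Sobolev constant of `B_ρ`) such that for every
centre `y`, `∫₀ᵀ∫_{B_ρ(y)} |v|³ ≤ K (∫₀ᵀ∫_{B_ρ(y)} |v|²)^{1/4}`: for a.e. slice,
`∫_B |v(s)|³ ≤ (2C_S)^{3/2} C₁^{1/2} a(s)^{1/4} (a(s) + e(s))^{3/4}` (`a = ∫_B |v(s)|²`,
`e = ∫_B |∇v(s)|²`, slice-wise Sobolev on the ball and Lebesgue interpolation), then Hölder
in time with exponents `4, 4/3`. [folklore] -/
theorem exists_lintegral_cube_box_le (h : IsLocalLeraySolutionOn T ν v₀ v π) (ρ : ℝ) :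
    ∃ K : ℝ≥0∞, K ≠ ∞ ∧ ∀ y : EuclideanSpace ℝ (Fin 3),
      ∫⁻ z in Ioo 0 T ×ˢ ball y ρ, ‖v z.1 z.2‖ₑ ^ (3 : ℕ) ≤
        K * (∫⁻ z in Ioo 0 T ×ˢ ball y ρ, ‖v z.1 z.2‖ₑ ^ (2 : ℕ)) ^ (1 / 4 : ℝ) := by
  -- ## a radius `R` with `ρ ≤ R`, `1 ≤ R`
  set R : ℝ := max ρ 1 with hR
  have hR1 : 1 ≤ R := le_max_right _ _
  have hRpos : 0 < R := by linarith
  have hρR : ρ ≤ R := le_max_left _ _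
  -- ## the data (2) of Def. 3.2 on the slab, the Sobolev constant of `B_ρ`
  obtain ⟨C₁, hC₁⟩ := h.uniformLocalEnergy R hRpos
  obtain ⟨G, hG, hGb⟩ := h.uniformLocalGradient
  obtain ⟨C₂, hC₂⟩ := hGb R hRpos
  obtain ⟨CS, hCS⟩ := exists_eLpNorm_six_le_ball_uniform finrank_euclideanSpace_three ρ
  -- ## constants
  set C₃ : ℝ≥0∞ := ((2 : ℝ≥0∞) * CS) ^ (3 / 2 : ℝ) * (C₁ : ℝ≥0∞) ^ (1 / 2 : ℝ)
    with hC₃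
  have hC₃top : C₃ ≠ ∞ :=
    ENNReal.mul_ne_top (ENNReal.rpow_ne_top_of_nonneg (by norm_num)
      (ENNReal.mul_ne_top (by simp) ENNReal.coe_ne_top))
      (ENNReal.rpow_ne_top_of_nonneg (by norm_num) ENNReal.coe_ne_top)
  set K : ℝ≥0∞ := C₃ * ((C₁ : ℝ≥0∞) * ENNReal.ofReal T + C₂) ^ (3 / 4 : ℝ) with hK
  have hKtop : K ≠ ∞ :=
    ENNReal.mul_ne_top hC₃top (ENNReal.rpow_ne_top_of_nonneg (by norm_num)
      (ENNReal.add_ne_top.2 ⟨ENNReal.mul_ne_top ENNReal.coe_ne_top ENNReal.ofReal_ne_top,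
        ENNReal.coe_ne_top⟩))
  refine ⟨K, hKtop, fun y => ?_⟩
  -- ## measurability of `v` and `G` on the slab
  have hslab : ((slab (EuclideanSpace ℝ (Fin 3)) (Ioo 0 T) isOpen_Ioo :
      Opens (ℝ × EuclideanSpace ℝ (Fin 3))) : Set (ℝ × EuclideanSpace ℝ (Fin 3))) =
      Ioo (0 : ℝ) T ×ˢ univ := rfl
  have hvm : AEStronglyMeasurable (uncurry v) (volume.restrict (Ioo (0 : ℝ) T ×ˢ univ)) :=
    h.aestronglyMeasurable
  have hGm : AEStronglyMeasurable (uncurry G) (volume.restrict (Ioo (0 : ℝ) T ×ˢ univ)) := by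
    rw [← hslab]
    exact hG.locallyIntegrableOn_grad.aestronglyMeasurable
  -- ## the bound at the centre `y`
  set B := ball y ρ with hB
  set Bo : Opens (EuclideanSpace ℝ (Fin 3)) := ⟨B, isOpen_ball⟩ with hBo
  set μt : Measure ℝ := volume.restrict (Ioo (0 : ℝ) T) with hμt
  set μx := (volume.restrict B : Measure (EuclideanSpace ℝ (Fin 3))) with hμx
  have hprod : μt.prod μx = volume.restrict (Ioo 0 T ×ˢ B) := by
    rw [hμt, hμx, Measure.prod_restrict, ← Measure.volume_eq_prod]
  have hsub : Ioo 0 T ×ˢ B ⊆ Ioo (0 : ℝ) T ×ˢ univ :=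
    Set.prod_mono Subset.rfl (subset_univ _)
  -- measurability on the box
  have hvmB : AEStronglyMeasurable (uncurry v) (μt.prod μx) := by
    rw [hprod]
    exact hvm.mono_measure (Measure.restrict_mono hsub le_rfl)
  have hGmB : AEStronglyMeasurable (uncurry G) (μt.prod μx) := by
    rw [hprod]
    exact hGm.mono_measure (Measure.restrict_mono hsub le_rfl)
  have hF3 : AEMeasurable
      (fun z : ℝ × EuclideanSpace ℝ (Fin 3) => ‖v z.1 z.2‖ₑ ^ (3 : ℕ)) (μt.prod μx) :=
    hvmB.enorm.pow_const _
  have hF2 : AEMeasurable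
      (fun z : ℝ × EuclideanSpace ℝ (Fin 3) => ‖v z.1 z.2‖ₑ ^ (2 : ℕ)) (μt.prod μx) :=
    hvmB.enorm.pow_const _
  have hFg : AEMeasurable (fun z : ℝ × EuclideanSpace ℝ (Fin 3) =>
      ENNReal.ofReal (frobeniusNormSq (G z.1 z.2))) (μt.prod μx) :=
    (continuous_frobeniusNormSq'.comp_aestronglyMeasurable hGmB).aemeasurable.ennreal_ofReal
  -- slice quantities and Tonelli
  set a : ℝ → ℝ≥0∞ := fun s => ∫⁻ x in B, ‖v s x‖ₑ ^ (2 : ℕ) with ha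
  set e : ℝ → ℝ≥0∞ := fun s => ∫⁻ x in B, ENNReal.ofReal (frobeniusNormSq (G s x))
    with he
  set g₃ : ℝ → ℝ≥0∞ := fun s => ∫⁻ x in B, ‖v s x‖ₑ ^ (3 : ℕ) with hg₃
  have ha_meas : AEMeasurable a μt := hF2.lintegral_prod_right'
  have he_meas : AEMeasurable e μt := hFg.lintegral_prod_right'
  have hT3 : ∫⁻ z in Ioo 0 T ×ˢ B, ‖v z.1 z.2‖ₑ ^ (3 : ℕ) = ∫⁻ s, g₃ s ∂μt := by
    rw [← hprod, lintegral_prod _ hF3]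
  have hT2 : ∫⁻ z in Ioo 0 T ×ˢ B, ‖v z.1 z.2‖ₑ ^ (2 : ℕ) = ∫⁻ s, a s ∂μt := by
    rw [← hprod, lintegral_prod _ hF2]
  have hTg : ∫⁻ z in Ioo 0 T ×ˢ B, ENNReal.ofReal (frobeniusNormSq (G z.1 z.2)) =
      ∫⁻ s, e s ∂μt := by
    rw [← hprod, lintegral_prod _ hFg]
  -- a.e. in `s`: the slice weak derivative and the energy bound
  set Qb : Opens (ℝ × EuclideanSpace ℝ (Fin 3)) :=
    ⟨Ioo 0 T ×ˢ (Bo : Set (EuclideanSpace ℝ (Fin 3))), isOpen_Ioo.prod Bo.isOpen⟩ with hQb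
  have hle : Qb ≤ slab (EuclideanSpace ℝ (Fin 3)) (Ioo 0 T) isOpen_Ioo := by
    show (Qb : Set (ℝ × EuclideanSpace ℝ (Fin 3))) ⊆ _
    rw [hslab]
    exact hsub
  have hslice : ∀ᵐ s ∂μt, FunctionSpaces.HasWeakFDerivOn Bo volume (v s) (G s) :=
    (hG.mono hle).ae_hasWeakFDerivOn_slice
  have henergy : ∀ᵐ s ∂μt, a s ≤ C₁ := by
    filter_upwards [hC₁] with s hs
    exact (lintegral_mono_set (ball_subset_ball hρR)).trans (hs y)
  -- the pointwise slice bound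
  have hpt : ∀ᵐ s ∂μt, g₃ s ≤ C₃ * (a s ^ (1 / 4 : ℝ) * (a s + e s) ^ (3 / 4 : ℝ)) := by
    filter_upwards [hslice, henergy] with s hs hen
    have h2 : eLpNorm (v s) 2 μx ≠ ∞ := by
      rw [hμx, eLpNorm_two_eq_rpow_lintegral_sq]
      exact ENNReal.rpow_ne_top_of_nonneg (by norm_num)
        (ne_top_of_le_ne_top ENNReal.coe_ne_top hen)
    have hsl := lintegral_cube_le_of_sobolev μx (hCS y (v s) (G s) hs h2)
      hs.locallyIntegrableOn.aestronglyMeasurable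
    have h34 : a s ^ (3 / 4 : ℝ) = a s ^ (1 / 4 : ℝ) * a s ^ (1 / 2 : ℝ) := by
      rw [← ENNReal.rpow_add_of_nonneg _ _ (by norm_num) (by norm_num)]
      norm_num
    have hhalf : a s ^ (1 / 2 : ℝ) ≤ (C₁ : ℝ≥0∞) ^ (1 / 2 : ℝ) :=
      ENNReal.rpow_le_rpow hen (by norm_num)
    calc g₃ s ≤ ((2 : ℝ≥0∞) * CS) ^ (3 / 2 : ℝ) * a s ^ (3 / 4 : ℝ) *
          (a s + e s) ^ (3 / 4 : ℝ) := hsl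
      _ = ((2 : ℝ≥0∞) * CS) ^ (3 / 2 : ℝ) * (a s ^ (1 / 4 : ℝ) * a s ^ (1 / 2 : ℝ)) *
          (a s + e s) ^ (3 / 4 : ℝ) := by rw [h34]
      _ ≤ ((2 : ℝ≥0∞) * CS) ^ (3 / 2 : ℝ) *
          (a s ^ (1 / 4 : ℝ) * (C₁ : ℝ≥0∞) ^ (1 / 2 : ℝ)) * (a s + e s) ^ (3 / 4 : ℝ) := by
        gcongr
      _ = C₃ * (a s ^ (1 / 4 : ℝ) * (a s + e s) ^ (3 / 4 : ℝ)) := by rw [hC₃]; ring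
  -- the time integrals of `a` and `e`
  have hIa : ∫⁻ s, a s ∂μt ≤ (C₁ : ℝ≥0∞) * ENNReal.ofReal T := by
    calc ∫⁻ s, a s ∂μt ≤ ∫⁻ _, (C₁ : ℝ≥0∞) ∂μt := lintegral_mono_ae henergy
      _ = (C₁ : ℝ≥0∞) * ENNReal.ofReal T := by
          rw [lintegral_const, hμt, Measure.restrict_apply_univ, Real.volume_Ioo, sub_zero]
  have hIe : ∫⁻ s, e s ∂μt ≤ C₂ := by
    rw [← hTg]
    exact (lintegral_mono_set (Set.prod_mono Subset.rfl (ball_subset_ball hρR))).trans (hC₂ y)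
  have hIae : ∫⁻ s, (a s + e s) ∂μt ≤ (C₁ : ℝ≥0∞) * ENNReal.ofReal T + C₂ := by
    rw [lintegral_add_left' ha_meas]
    exact add_le_add hIa hIe
  -- integrate the slice bound
  calc ∫⁻ z in Ioo 0 T ×ˢ B, ‖v z.1 z.2‖ₑ ^ (3 : ℕ) = ∫⁻ s, g₃ s ∂μt := hT3
    _ ≤ ∫⁻ s, C₃ * (a s ^ (1 / 4 : ℝ) * (a s + e s) ^ (3 / 4 : ℝ)) ∂μt :=
        lintegral_mono_ae hpt
    _ = C₃ * ∫⁻ s, a s ^ (1 / 4 : ℝ) * (a s + e s) ^ (3 / 4 : ℝ) ∂μt :=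
        lintegral_const_mul' _ _ hC₃top
    _ ≤ C₃ * ((∫⁻ s, a s ∂μt) ^ (1 / 4 : ℝ) * (∫⁻ s, (a s + e s) ∂μt) ^ (3 / 4 : ℝ)) := by
        gcongr
        exact lintegral_rpow_quarter_mul_le μt ha_meas (ha_meas.add he_meas)
    _ ≤ C₃ * ((∫⁻ s, a s ∂μt) ^ (1 / 4 : ℝ) *
          ((C₁ : ℝ≥0∞) * ENNReal.ofReal T + C₂) ^ (3 / 4 : ℝ)) := by
        gcongr
    _ = K * (∫⁻ z in Ioo 0 T ×ˢ B, ‖v z.1 z.2‖ₑ ^ (2 : ℕ)) ^ (1 / 4 : ℝ) := by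
        rw [hT2, hK]
        ring

/-- **`∫₀ᵀ∫_{B_ρ(y)} |v|³ < ∞`** for a local Leray solution on `(0, T) × ℝ³`
(Kang–Miura–Tsai 2021, remark after Lemma 3.3: "It is standard to see that `A` is finite by
using properties 2–5 and the Sobolev embedding"). [folklore] -/
theorem lintegral_cube_box_lt_top (h : IsLocalLeraySolutionOn T ν v₀ v π)
    (y : EuclideanSpace ℝ (Fin 3)) (ρ : ℝ) :
    ∫⁻ z in Ioo 0 T ×ˢ ball y ρ, ‖v z.1 z.2‖ₑ ^ (3 : ℕ) < ∞ := by
  obtain ⟨K, hK, hKy⟩ := h.exists_lintegral_cube_box_le ρ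
  refine lt_of_le_of_lt (hKy y) (ENNReal.mul_lt_top hK.lt_top ?_)
  refine ENNReal.rpow_lt_top_of_nonneg (by norm_num) ?_
  -- `∫₀ᵀ∫_{B_ρ(y)} |v|² < ∞` from the square integrability on `(0,T) × B̄_ρ(y)`
  have h2 : ∫⁻ z in Ioo 0 T ×ˢ ball y ρ, ‖v z.1 z.2‖ₑ ^ (2 : ℕ) ≤
      ∫⁻ z in Ioo 0 T ×ˢ closedBall y ρ, ‖v z.1 z.2‖ₑ ^ 2 :=
    lintegral_mono_set (Set.prod_mono Subset.rfl ball_subset_closedBall)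
  exact ne_top_of_le_ne_top (h.sqIntegrable _ (isCompact_closedBall y ρ)).ne h2

/-- **`|v|³ ∈ L¹_loc` on the open slab `(0, T) × ℝ³`** for a local Leray solution on the
slab — the integrability hypothesis `hu3` of the tree's sliced local energy inequality
`IsSuitableWeakSolutionOn.ae_localEnergy_slice` (a compact subset of the slab lies in a box
`(0,T) × B_n(0)`, on which `∫∫ |v|³ < ∞` by `lintegral_cube_box_lt_top`). [folklore] -/
theorem locallyIntegrableOn_cube (h : IsLocalLeraySolutionOn T ν v₀ v π) :
    LocallyIntegrableOn (fun z : ℝ × EuclideanSpace ℝ (Fin 3) => ‖v z.1 z.2‖ ^ 3)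
      ((slab (EuclideanSpace ℝ (Fin 3)) (Ioo 0 T) isOpen_Ioo :
        Opens (ℝ × EuclideanSpace ℝ (Fin 3))) : Set (ℝ × EuclideanSpace ℝ (Fin 3))) volume := by
  refine (locallyIntegrableOn_iff (isOpen_Ioo.prod isOpen_univ).isLocallyClosed).2
    fun K hK hKc => ?_
  -- `K ⊆ (0,T) × B_n(0)` for some `n`
  obtain ⟨r, hr⟩ := (hKc.image continuous_snd).isBounded.subset_ball (0 : EuclideanSpace ℝ (Fin 3))
  have hKsub : K ⊆ Ioo (0 : ℝ) T ×ˢ ball (0 : EuclideanSpace ℝ (Fin 3)) r := by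
    intro z hz
    have h1 : z ∈ Ioo (0 : ℝ) T ×ˢ (univ : Set (EuclideanSpace ℝ (Fin 3))) := hK hz
    exact ⟨h1.1, hr (mem_image_of_mem _ hz)⟩
  refine IntegrableOn.mono_set ?_ hKsub
  -- integrability on the box: measurability and the finite cubic functional
  have hmeas : AEStronglyMeasurable (fun z : ℝ × EuclideanSpace ℝ (Fin 3) => ‖v z.1 z.2‖ ^ 3)
      (volume.restrict (Ioo (0 : ℝ) T ×ˢ ball (0 : EuclideanSpace ℝ (Fin 3)) r)) := by
    have h1 : AEStronglyMeasurable (uncurry v)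
        (volume.restrict (Ioo (0 : ℝ) T ×ˢ ball (0 : EuclideanSpace ℝ (Fin 3)) r)) :=
      h.aestronglyMeasurable.mono_measure
        (Measure.restrict_mono (Set.prod_mono Subset.rfl (subset_univ _)) le_rfl)
    exact (h1.norm.pow 3)
  refine ⟨hmeas, ?_⟩
  rw [hasFiniteIntegral_iff_enorm]
  refine lt_of_le_of_lt (lintegral_mono fun z => le_of_eq ?_) (h.lintegral_cube_box_lt_top 0 r)
  rw [Real.enorm_eq_ofReal (pow_nonneg (norm_nonneg _) 3), ← ofReal_norm,
    ENNReal.ofReal_pow (norm_nonneg _)]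

/-- **The velocity and its square are integrable on finite cylinders** `(0,T) × K`, `K`
compact (from the clause `v ∈ L²((0,T) × K)`; `L² ⊂ L¹` on finite measure). [folklore] -/
theorem integrableOn_velocity (h : IsLocalLeraySolutionOn T ν v₀ v π)
    {K : Set (EuclideanSpace ℝ (Fin 3))} (hK : IsCompact K) :
    IntegrableOn (uncurry v) (Ioo 0 T ×ˢ K) volume ∧
      IntegrableOn (fun z => ‖uncurry v z‖ ^ 2) (Ioo 0 T ×ˢ K) volume :=
  integrableOn_cylinder_of_lintegral_sq_slab h.aestronglyMeasurable
    (fun K hK => h.sqIntegrable K hK) hK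

/-- **The pressure is integrable on finite cylinders** `(0,T) × K`, `K` compact: the
clause `π ∈ L^{3/2}((0,T) × K)` and `|π| ≤ 1 + |π|^{3/2}` on the finite cylinder. [folklore] -/
theorem integrableOn_pressure (h : IsLocalLeraySolutionOn T ν v₀ v π)
    {K : Set (EuclideanSpace ℝ (Fin 3))} (hK : IsCompact K) :
    IntegrableOn (uncurry π) (Ioo 0 T ×ˢ K) volume := by
  -- measurability on the cylinder, from local integrability on the open slab
  have hslab : ((slab (EuclideanSpace ℝ (Fin 3)) (Ioo 0 T) isOpen_Ioo :
      Opens (ℝ × EuclideanSpace ℝ (Fin 3))) : Set (ℝ × EuclideanSpace ℝ (Fin 3))) =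
      Ioo (0 : ℝ) T ×ˢ univ := rfl
  have hπm : AEStronglyMeasurable (uncurry π)
      (volume.restrict (Ioo (0 : ℝ) T ×ˢ (univ : Set (EuclideanSpace ℝ (Fin 3))))) := by
    rw [← hslab]
    exact h.distributional.2.2.1.aestronglyMeasurable
  have hπmK : AEStronglyMeasurable (uncurry π) (volume.restrict (Ioo (0 : ℝ) T ×ˢ K)) :=
    hπm.mono_measure (Measure.restrict_mono (Set.prod_mono Subset.rfl (subset_univ _)) le_rfl)
  refine ⟨hπmK, ?_⟩
  rw [hasFiniteIntegral_iff_enorm]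
  calc ∫⁻ z in Ioo 0 T ×ˢ K, ‖uncurry π z‖ₑ
      ≤ ∫⁻ z in Ioo 0 T ×ˢ K, (1 + ‖π z.1 z.2‖ₑ ^ (3 / 2 : ℝ)) :=
        lintegral_mono fun z => ennreal_le_one_add_rpow_three_halves _
    _ = (∫⁻ _ in Ioo 0 T ×ˢ K, (1 : ℝ≥0∞)) + ∫⁻ z in Ioo 0 T ×ˢ K, ‖π z.1 z.2‖ₑ ^ (3 / 2 : ℝ) :=
        lintegral_add_left measurable_const _
    _ < ∞ := by
        refine ENNReal.add_lt_top.2 ⟨?_, h.pressure K hK⟩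
        rw [setLIntegral_const, one_mul]
        exact volume_Ioo_prod_lt_top hK

end IsLocalLeraySolutionOn

/-! ## The same for Seregin's class -/

namespace IsLocalEnergySolutionOn

variable {T ν : ℝ} {v₀ : EuclideanSpace ℝ (Fin 3) → EuclideanSpace ℝ (Fin 3)}
  {v : ℝ → EuclideanSpace ℝ (Fin 3) → EuclideanSpace ℝ (Fin 3)}
  {π : ℝ → EuclideanSpace ℝ (Fin 3) → ℝ}

/-- `∫₀ᵀ∫_{B_ρ(y)} |v|³ < ∞` for a local energy solution on `ℝ³ × (0, T)` (Seregin 2014,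
(B.2.3)–(B.2.4): `γ^{2/3}(T) ≤ A`). [folklore] -/
theorem lintegral_cube_box_lt_top (h : IsLocalEnergySolutionOn T ν v₀ v π)
    (y : EuclideanSpace ℝ (Fin 3)) (ρ : ℝ) :
    ∫⁻ z in Ioo 0 T ×ˢ ball y ρ, ‖v z.1 z.2‖ₑ ^ (3 : ℕ) < ∞ :=
  h.isLocalLeraySolutionOn.lintegral_cube_box_lt_top y ρ

/-- `|v|³ ∈ L¹_loc` on the open slab for a local energy solution on `ℝ³ × (0, T)`. [folklore] -/
theorem locallyIntegrableOn_cube (h : IsLocalEnergySolutionOn T ν v₀ v π) :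
    LocallyIntegrableOn (fun z : ℝ × EuclideanSpace ℝ (Fin 3) => ‖v z.1 z.2‖ ^ 3)
      ((slab (EuclideanSpace ℝ (Fin 3)) (Ioo 0 T) isOpen_Ioo :
        Opens (ℝ × EuclideanSpace ℝ (Fin 3))) : Set (ℝ × EuclideanSpace ℝ (Fin 3))) volume :=
  h.isLocalLeraySolutionOn.locallyIntegrableOn_cube

/-- The velocity of a local energy solution and its square are integrable on finite
cylinders `(0,T) × K`. [folklore] -/
theorem integrableOn_velocity (h : IsLocalEnergySolutionOn T ν v₀ v π)
    {K : Set (EuclideanSpace ℝ (Fin 3))} (hK : IsCompact K) :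
    IntegrableOn (uncurry v) (Ioo 0 T ×ˢ K) volume ∧
      IntegrableOn (fun z => ‖uncurry v z‖ ^ 2) (Ioo 0 T ×ˢ K) volume :=
  h.isLocalLeraySolutionOn.integrableOn_velocity hK

/-- The pressure of a local energy solution is integrable on finite cylinders `(0,T) × K`
((B.1.4): `p ∈ L_{3/2}(0,T; L_{3/2,loc})`). [folklore] -/
theorem integrableOn_pressure (h : IsLocalEnergySolutionOn T ν v₀ v π)
    {K : Set (EuclideanSpace ℝ (Fin 3))} (hK : IsCompact K) :
    IntegrableOn (uncurry π) (Ioo 0 T ×ˢ K) volume :=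
  h.isLocalLeraySolutionOn.integrableOn_pressure hK

end IsLocalEnergySolutionOn

end Literature.Analysis.FluidPDE
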